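import Summits.QuantumFields.YangMills.Theses.ThermalTraceWindow
import Summits.QuantumFields.YangMills.Theorems.LuscherReductionRunningReductionTraceFormula
import Summits.QuantumFields.YangMills.Theorems.FemtoTransferGapBounds
import Summits.QuantumFields.YangMills.Theorems.FemtoTransferGapPositivity
import HarnessLib

/-!
# `ThermalTraceWindow.Assembly` — the bookkeeping of route `ThermalTraceWindow` (item stmt-QuantumFields-28258) — PROVED

Route `ThermalTraceWindow` (D-0145 LINE of seat ym-idea-4, rung R2ξ″ = `AllWindowsColdBox.XiSuperPolySU2`) has two cruxes,
`GapQuenchesFemtoEntropy` (K1: an RP gap `m` of a torus-limit state quenches the zero-flux thermal entropy of every spatial torus,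
`Z_phys(L×L³) ≤ (1 + C β^q L^p e^{-θ m L}) λ₀^L`) and `SubFemtoTraceRatio` (K2: in the sub-femto window `L ≤ β^A` the dyadic
zero-flux trace ratio obeys `Z_phys(2L×L³) ≤ (1 - β^{-k}) Z_phys(L×L³)²`), and the item `Assembly : K1 → K2 → XiSuperPolySU2`.
This file proves `Assembly` outright (`assembly_holds`), so the deciding theorem `closes h₁ h₂ hA := hA h₁ h₂` is kernel-certified
modulo exactly K1 and K2.

The proof is real analysis over two PROVED tree facts: the trace formula `TT.traceFormula_all` (= `LuscherReduction.TraceFormula`, `traceFormula_proof`)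
(`Σ_k λ_k^T = Z_phys(T)` as a `HasSum` of non-negative terms, whence `λ₀^{2L} ≤ Z_phys(2L)`), and `levelValue_zero_su2Rep_pos` (`λ₀ > 0`).
Fix `A > 0`, take K2 at exponent `A+1` and `L = ⌊β^{A+1}⌋`. If a limit state at `β` has RP gap `m`, then
`λ₀^{2L} ≤ Z(2L) ≤ (1-δ) Z(L)² ≤ (1-δ)(1+ε)² λ₀^{2L}` (`δ = β^{-k}`, `ε = C β^q L^p e^{-θ m L}`) forces `δ ≤ 3ε`; were `m > β^{-A}`
we would have `m L ≥ β - 1` and `ε ≤ C e^θ β^s e^{-θβ} < δ/3` for large `β` (`x^{s+k} e^{-θx} → 0`), a contradiction. Hence `m ≤ β^{-A}`: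
`MassGapPowerDecayOf … A` for every `A`, i.e. `XiSuperPolySU2`.

HONEST FRAMING: bookkeeping only; no RG statement, no crux is touched, no summit (`YangMills`) is proved — the rung itself stays open
behind K1 and K2.
-/

open Literature.MathematicalPhysics.QuantumLattice
open Summit.QuantumFields.YangMills.Theorems
open Summit.QuantumFields.YangMills.Theorems.FemtoTransferGap

namespace Summit.QuantumFields.YangMills.Theses.ThermalTraceWindow

/-- Elementary: from `1 ≤ (1 - δ)(1 + ε)²` with `δ > 0`, `ε ≥ 0` one gets `δ ≤ 3ε`. -/
private lemma delta_le_three_eps {δ ε : ℝ} (hδ : 0 < δ) (hε : 0 ≤ ε)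
    (hkey : 1 ≤ (1 - δ) * (1 + ε) ^ 2) : δ ≤ 3 * ε := by
  have hexp : (1 - δ) * (1 + ε) ^ 2 = (1 + ε) ^ 2 - δ * (1 + ε) ^ 2 := by ring
  have hA : δ * (1 + ε) ^ 2 ≤ 2 * ε + ε ^ 2 := by nlinarith [hkey, hexp]
  have hsqpos : 0 < (1 + ε) ^ 2 := by positivity
  by_cases hε1 : ε < 1
  · have hε2 : ε ^ 2 ≤ ε := by nlinarith
    have h1e : δ ≤ δ * (1 + ε) ^ 2 := by nlinarith
    linarith
  · push Not at hε1
    have hlt : δ * (1 + ε) ^ 2 < 1 * (1 + ε) ^ 2 := by nlinarith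
    have hδ1 : δ < 1 := lt_of_mul_lt_mul_right hlt hsqpos.le
    linarith

/-- **`Assembly` holds** (item stmt-QuantumFields-28258): `GapQuenchesFemtoEntropy → SubFemtoTraceRatio → AllWindowsColdBox.XiSuperPolySU2`. -/
theorem assembly_holds : Assembly := by
  intro h1 h2 A hA
  obtain ⟨θ, C, q, p, hθ, hC, β₁, h1⟩ := h1
  obtain ⟨k, β₀, L₀, h2⟩ := h2 (A + 1) (by linarith)
  -- exponents made non-negative, and the decay `x^(s+k) e^{-θ x} → 0`
  set q' : ℝ := max q 0 with hq'
  set p' : ℝ := max p 0 with hp'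
  set s : ℝ := q' + (A + 1) * p' with hs
  have hc₀ : (0 : ℝ) < 1 / (3 * C * Real.exp θ) := by positivity
  have hev := (tendsto_rpow_mul_exp_neg_mul_atTop_nhds_zero (s + k) θ hθ).eventually (gt_mem_nhds hc₀)
  obtain ⟨β₂, hβ₂⟩ := Filter.eventually_atTop.mp hev
  show WeakCouplingRates.MassGapPowerDecayOf (G := SU2) 4 su2Rep A
  unfold WeakCouplingRates.MassGapPowerDecayOf WeakCouplingRates.MassGapUpperRateOf
  refine ⟨max β₀ (max β₁ (max β₂ (max 2 ((L₀ : ℝ) + 3)))), fun β hβ μ hμ m hgap => ?_⟩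
  simp only [max_le_iff] at hβ
  obtain ⟨hβ0, hβ1, hβ2, hβtwo, hβL⟩ := hβ
  have hm : 0 < m := hgap.1
  have hL₀nn : (0 : ℝ) ≤ L₀ := Nat.cast_nonneg _
  have hβpos : 0 < β := by linarith
  have hβ1' : 1 ≤ β := by linarith
  -- the scale `L = ⌊β^(A+1)⌋`
  set L : ℕ := ⌊β ^ (A + 1)⌋₊ with hLdef
  have hβA1 : β ≤ β ^ (A + 1) := by
    calc β = β ^ (1 : ℝ) := (Real.rpow_one β).symm
      _ ≤ β ^ (A + 1) := Real.rpow_le_rpow_of_exponent_le hβ1' (by linarith)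
  have hLle : (L : ℝ) ≤ β ^ (A + 1) := Nat.floor_le (by positivity)
  have hLgt : β ^ (A + 1) - 1 < L := by
    have := Nat.lt_floor_add_one (β ^ (A + 1)); linarith
  have hL2r : (2 : ℝ) ≤ L := by linarith
  have hL2 : 2 ≤ L := by exact_mod_cast hL2r
  have hLL₀ : L₀ ≤ L := by
    have : (L₀ : ℝ) ≤ L := by linarith
    exact_mod_cast this
  haveI : NeZero L := ⟨by omega⟩
  have hLpos : (0 : ℝ) < L := by linarith
  have hL1 : (1 : ℝ) ≤ L := by linarith
  -- level values: `λ₀ > 0`, all `λ_j ≥ 0`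
  have hlam0 : 0 < levelValue su2Rep L β 0 := levelValue_zero_su2Rep_pos L β
  have hlamnn : ∀ j, 0 ≤ levelValue su2Rep L β j := fun j =>
    levelValue_nonneg_of_qform_nonneg su2Rep β (fun ψ hψ => qform_su2Rep_self_nonneg hβpos.le hψ) j
  -- the proved trace formula: `λ₀^T ≤ Z_phys(T)`
  have hTF := TT.traceFormula_all
  have hsum1 := hTF L β L hβ1' hL2
  have hsum2 := hTF L β (2 * L) hβ1' (by omega)
  have hZ1 : levelValue su2Rep L β 0 ^ L ≤ TT.physTrace L β L :=
    le_hasSum hsum1 0 (fun j _ => pow_nonneg (hlamnn j) _)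
  have hZ2 : levelValue su2Rep L β 0 ^ (2 * L) ≤ TT.physTrace L β (2 * L) :=
    le_hasSum hsum2 0 (fun j _ => pow_nonneg (hlamnn j) _)
  have hZ1pos : 0 < TT.physTrace L β L := lt_of_lt_of_le (pow_pos hlam0 _) hZ1
  -- K1 and K2 at this `(β, L)`
  set ε : ℝ := C * β ^ q * (L : ℝ) ^ p * Real.exp (-(θ * m * L)) with hεdef
  have hε0 : 0 ≤ ε := by positivity
  have hK1 : TT.physTrace L β L ≤ (1 + ε) * levelValue su2Rep L β 0 ^ L :=
    h1 β hβ1 m hm ⟨μ, hμ, hgap⟩ L hL2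
  set δ : ℝ := β ^ (-k) with hδdef
  have hδpos : 0 < δ := Real.rpow_pos_of_pos hβpos _
  have hK2 : TT.physTrace L β (2 * L) ≤ (1 - δ) * TT.physTrace L β L ^ 2 := h2 β hβ0 L hLL₀ hLle
  -- the chain `λ₀^{2L} ≤ (1-δ)(1+ε)² λ₀^{2L}`
  have h1δ : 0 < 1 - δ := by
    by_contra hneg
    push Not at hneg
    have hnp : (1 - δ) * TT.physTrace L β L ^ 2 ≤ 0 :=
      mul_nonpos_of_nonpos_of_nonneg hneg (sq_nonneg _)
    linarith [pow_pos hlam0 (2 * L)]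
  have hchain : levelValue su2Rep L β 0 ^ (2 * L) ≤ (1 - δ) * ((1 + ε) * levelValue su2Rep L β 0 ^ L) ^ 2 :=
    calc levelValue su2Rep L β 0 ^ (2 * L) ≤ TT.physTrace L β (2 * L) := hZ2
      _ ≤ (1 - δ) * TT.physTrace L β L ^ 2 := hK2
      _ ≤ (1 - δ) * ((1 + ε) * levelValue su2Rep L β 0 ^ L) ^ 2 :=
          mul_le_mul_of_nonneg_left (pow_le_pow_left₀ hZ1pos.le hK1 2) h1δ.le
  have hx : 0 < levelValue su2Rep L β 0 ^ L := pow_pos hlam0 _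
  have hkey : 1 ≤ (1 - δ) * (1 + ε) ^ 2 := by
    have h' : 1 * (levelValue su2Rep L β 0 ^ L) ^ 2 ≤ ((1 - δ) * (1 + ε) ^ 2) * (levelValue su2Rep L β 0 ^ L) ^ 2 := by
      have hpm : levelValue su2Rep L β 0 ^ (2 * L) = (levelValue su2Rep L β 0 ^ L) ^ 2 := by
        rw [mul_comm, pow_mul]
      rw [hpm] at hchain
      calc 1 * (levelValue su2Rep L β 0 ^ L) ^ 2 = (levelValue su2Rep L β 0 ^ L) ^ 2 := one_mul _
        _ ≤ (1 - δ) * ((1 + ε) * levelValue su2Rep L β 0 ^ L) ^ 2 := hchain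
        _ = ((1 - δ) * (1 + ε) ^ 2) * (levelValue su2Rep L β 0 ^ L) ^ 2 := by ring
    exact le_of_mul_le_mul_right h' (pow_pos hx 2)
  have hδ3ε : δ ≤ 3 * ε := delta_le_three_eps hδpos hε0 hkey
  -- suppose, for contradiction, `m > β^{-A}`: then `ε < δ/3`
  by_contra hmA
  push Not at hmA
  have hmL : β - 1 ≤ m * L := by
    have hβAnn : 0 ≤ β ^ (-A) := Real.rpow_nonneg hβpos.le _
    have h1 : β ^ (-A) * L ≤ m * L := mul_le_mul_of_nonneg_right hmA.le hLpos.le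
    have h2 : β ^ (-A) * (β ^ (A + 1) - 1) ≤ β ^ (-A) * L := mul_le_mul_of_nonneg_left hLgt.le hβAnn
    have h3 : β ^ (-A) * (β ^ (A + 1) - 1) = β - β ^ (-A) := by
      rw [mul_sub, mul_one, ← Real.rpow_add hβpos]
      norm_num
    have h4 : β ^ (-A) ≤ 1 := Real.rpow_le_one_of_one_le_of_nonpos hβ1' (by linarith)
    linarith
  have hexp : Real.exp (-(θ * m * L)) ≤ Real.exp θ * Real.exp (-θ * β) := by
    rw [← Real.exp_add]
    apply Real.exp_le_exp.mpr
    have : θ * (β - 1) ≤ θ * (m * L) := mul_le_mul_of_nonneg_left hmL hθ.le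
    nlinarith
  have hβq : β ^ q ≤ β ^ q' := Real.rpow_le_rpow_of_exponent_le hβ1' (le_max_left _ _)
  have hLp : (L : ℝ) ^ p ≤ (L : ℝ) ^ p' := Real.rpow_le_rpow_of_exponent_le hL1 (le_max_left _ _)
  have hLp' : (L : ℝ) ^ p' ≤ (β ^ (A + 1)) ^ p' := Real.rpow_le_rpow hLpos.le hLle (le_max_right _ _)
  have hββ : (β ^ (A + 1)) ^ p' = β ^ ((A + 1) * p') := (Real.rpow_mul hβpos.le _ _).symm
  have hεle : ε ≤ C * Real.exp θ * (β ^ s * Real.exp (-θ * β)) := by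
    have hb : β ^ q * (L : ℝ) ^ p ≤ β ^ q' * β ^ ((A + 1) * p') := by
      rw [← hββ]
      exact mul_le_mul hβq (hLp.trans hLp') (Real.rpow_nonneg hLpos.le _) (Real.rpow_nonneg hβpos.le _)
    have hsplit : β ^ s = β ^ q' * β ^ ((A + 1) * p') := by
      rw [hs, Real.rpow_add hβpos]
    calc ε = C * (β ^ q * (L : ℝ) ^ p) * Real.exp (-(θ * m * L)) := by rw [hεdef]; ring
      _ ≤ C * (β ^ q' * β ^ ((A + 1) * p')) * (Real.exp θ * Real.exp (-θ * β)) :=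
          mul_le_mul (mul_le_mul_of_nonneg_left hb hC.le) hexp (Real.exp_pos _).le (by positivity)
      _ = C * Real.exp θ * (β ^ s * Real.exp (-θ * β)) := by rw [hsplit]; ring
  have hsmall : β ^ (s + k) * Real.exp (-θ * β) < 1 / (3 * C * Real.exp θ) := hβ₂ β hβ2
  have hsk : β ^ s = β ^ (s + k) * δ := by
    rw [hδdef, ← Real.rpow_add hβpos]; ring_nf
  have hεlt : ε < δ / 3 := by
    have hce : 0 < C * Real.exp θ := by positivity
    calc ε ≤ C * Real.exp θ * (β ^ s * Real.exp (-θ * β)) := hεle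
      _ = (C * Real.exp θ * (β ^ (s + k) * Real.exp (-θ * β))) * δ := by rw [hsk]; ring
      _ < (C * Real.exp θ * (1 / (3 * C * Real.exp θ))) * δ :=
          mul_lt_mul_of_pos_right (mul_lt_mul_of_pos_left hsmall hce) hδpos
      _ = δ / 3 := by field_simp
  linarith

end Summit.QuantumFields.YangMills.Theses.ThermalTraceWindow
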